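import Literature.Topology.FourManifolds.HomotopySpheresE8PlumbingReduction
import Literature.Topology.FourManifolds.HomotopySpheresBPOrderSignatureUnimodular
import Literature.Topology.FourManifolds.ClosedModelRelOrientation
import HarnessLib

/-!
# The `E₈` leaf from eight middle-dimensional classes of the closed model (Kosinski VI.12)

Topic `Literature/Topology/FourManifolds`; third file of the fact seat of
`Literature.Topology.FourManifolds.HomotopySphere.exists_intersectionForm_equivalent_e8Form`
(`HomotopySpheresBPOrderSignatureLeaves.lean`; A. Kosinski, *Differential Manifolds* (1993),
VI.12: the plumbing `M(4n)` along the `E₈` tree has intersection matrix `Γ₈`, its boundary is a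
homotopy sphere by (12.2), it is parallelizable by IX.(7.5); used in X §6, proof of
Prop. 6.2(a), p. 216), sequel of `HomotopySpheresE8PlumbingReduction.lean`. Everything here is
**proved**; no definition, no named fact (D-0026).

`HomotopySpheresE8PlumbingReduction.lean` reduced the fact to Kosinski's printed datum read in a
BASIS of `H²ᵐ(M̂; ℤ)/T` (`M̂ = M ∪ cone(bM)` the closed model) and, in
`exists_intersectionForm_equivalent_e8Form_of_isRelFundamentalClass`, to geometric data including
a topological-manifold structure on `M̂` — available for a homotopy-sphere boundary of dimension
`≥ 5` only through the generalised Poincaré conjecture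
(`HomotopySphere.nonempty_chartedSpace_closedModel`). Since then the tree has acquired the
chart-free orientation of the closed model (`NullCobordism.closedModelOrientation`,
`ClosedModelRelOrientation.lean`: Kervaire–Milnor's "closed homology manifold" `W ∪ cone(bW)`,
footnote pp. 528–529) and duality modulo torsion on it for every null-cobordism of a homotopy
sphere (`HomotopySphere.isUnimodular_intersectionForm_closedModel`,
`HomotopySpheresBPOrderSignatureUnimodular.lean`). This file uses them to bring the remaining
hypothesis down to **eight cohomology classes and their `8 × 8` table of cup products**, with no
manifold structure on `M̂`, no basis and no orientation to be supplied:

* `Literature.Topology.FourManifolds.exists_basis_of_isUnit_eval`,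
  `Literature.Topology.FourManifolds.exists_basis_of_isUnit_gram` (**algebra, proved**): in a
  finitely generated free module `L` of rank `≤ r` over a commutative ring, `r` vectors on which `r`
  functionals (e.g. `B(·, vⱼ)` for a bilinear form `B`) have an invertible matrix form a basis of `L` (they are linearly
  independent, so the rank is `r`; the "coordinate" map `x ↦ (B(x, vⱼ))ⱼ` is then a surjective
  endomorphism of `L ≅ Rʳ` up to isomorphism, hence injective — Vasconcelos / Orzech, Mathlib's
  `OrzechProperty.injective_of_surjective_endomorphism`). Milnor–Husemoller, *Symmetric bilinear
  forms* (1973), I §3 (a sublattice on which the form is unimodular splits off; here it is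
  everything by rank). Also `isUnit_kosinskiGamma8`: `Γ₈ = Pᵀ E₈ P` is invertible over `ℤ`.
* `Literature.Topology.FourManifolds.HomotopySphere.exists_intersectionForm_equivalent_e8Form_of_kroneckerPairing`
  (**the reduction, proved**): the named fact follows from — for `n + 1 = 4m`, `1 < m` — a homotopy
  `n`-sphere `Σ`, a null-cobordism `c` of `Σ` with `c.W` s-parallelizable (Kosinski IX.(7.5):
  `M(4n)` is parallelizable), a relative fundamental class `z = [W, ∂W]`, the bound
  `rank H²ᵐ(M̂; ℤ)/T ≤ 8`, and eight classes `a₁, …, a₈ ∈ H²ᵐ(M̂; ℤ)` whose cup products evaluate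
  on the class `ẑ = j⁻¹ q_* z ∈ H₄ₘ(M̂; ℤ)` of the closed model (`NullCobordism.closedModelClass`)
  to `⟨aᵢ ⌣ aᵢ, ẑ⟩ = 2` for all `i` or `-2` for all `i` (VI.(12.4): `[Σᵢ : Σᵢ] = φ_*(τ₂ₘ) = 2`, up
  to the orientation of `W`) and `|⟨aᵢ ⌣ aⱼ, ẑ⟩| = (Γ₈)ᵢⱼ` for `i ≠ j` ("`[Σ₁ : Σ₂] = ±1`", the
  `E₈` tree). Proof: orient `M̂` by `z` (or by `-z` if the diagonal is `-2`; `ẑ` changes sign,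
  `closedModelClass_neg`), so that `[M̂] = ±ẑ` and the table is the table `g` of the cup-product
  form with diagonal `2`; with Kosinski's sign change `s` along the tree (`kosinskiSigns`,
  `kosinskiSigns_mul_mul`) `g = diag(s) Γ₈ diag(s)` is invertible over `ℤ`
  (`isUnit_kosinskiGamma8`), and `H²ᵐ(M̂; ℤ)` is finitely generated
  (`isUnimodular_intersectionForm_closedModel`) with `rank H²ᵐ/T ≤ 8`, so the images of the
  classes in `H²ᵐ(M̂; ℤ)/T` are a basis by `exists_basis_of_isUnit_gram`; the boundary orientation
  `∂z` makes `(Σ, μ) = bM` (`NullCobordism.isOrientedBy_closedModelOrientation`); conclude by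
  `exists_intersectionForm_equivalent_e8Form_of_gamma8'` (which allows `±1` off the diagonal).

What remains for the discharge `exists_intersectionForm_equivalent_e8Form_holds` is thus exactly
the construction of `M(4m)` with its homotopy-sphere boundary and the computation of the eight
numbers `⟨aᵢ ⌣ aⱼ, ẑ⟩` for the duals of its core spheres (Kosinski VI.12, (12.2)–(12.4)), plus
`rank H²ᵐ ≤ 8`.

## References

* A. Kosinski, *Differential Manifolds* (1993), VI.12 (pp. 119–122: `M(4n)`, `Γ₈` on p. 122,
  (12.2), (12.3), (12.4)), IX.(7.5) (p. 188), X §6 proof of Prop. 6.2(a) (p. 216). [Kosinski1993]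
* M. Kervaire, J. Milnor, *Groups of homotopy spheres I*, Ann. of Math. 77 (1963), §2 ("`-M`"),
  §7 with footnote pp. 528–529. [KervaireMilnorAnnals1963]
* J. Milnor, D. Husemoller, *Symmetric bilinear forms* (1973), I §3, II §6. [MilnorHusemoller1973]
* A. Hatcher, *Algebraic Topology* (2002), §3.3 pp. 249–250, Prop. 3.38. [HatcherAT2002]
-/

open scoped Manifold ContDiff Topology Matrix
open Set Function

noncomputable section

namespace Literature.Topology.FourManifolds

open Literature.AlgebraicTopology.SingularHomology

/-! ### Vectors with an invertible Gram matrix in a free module of the right rank form a basis -/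

/-- Evaluating a functional `fⱼ` on a combination `∑ cᵢ vᵢ` gives the `j`-th entry of `c · G`,
`G = (fⱼ(vᵢ))ᵢⱼ`. [folklore] -/
theorem apply_linearCombination_eq_vecMul {R : Type*} [CommRing R] {L : Type*}
    [AddCommGroup L] [Module R L] {r : ℕ} (f : Fin r → L →ₗ[R] R) (v : Fin r → L)
    (c : Fin r → R) (j : Fin r) :
    f j (Fintype.linearCombination R v c) =
      Matrix.vecMul c (Matrix.of fun i j => f j (v i)) j := by
  simp only [Fintype.linearCombination_apply, map_sum, map_smul, smul_eq_mul, Matrix.vecMul,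
    dotProduct, Matrix.of_apply]

/-- **Vectors on which `r` functionals have an invertible matrix form a basis.** Let `L` be a
finitely generated free module over a nontrivial commutative ring `R` with `rank L ≤ r`,
`f₁, …, fᵣ : L → R` linear and `v₁, …, vᵣ ∈ L` with invertible matrix `G = (fⱼ(vᵢ))ᵢⱼ`. Then `v`
is a basis of `L`: a relation `∑ cᵢ vᵢ = 0` gives `c · G = 0`, so `v` is linearly independent and
`rank L = r`; the map `x ↦ (fⱼ(x))ⱼ : L → Rʳ` is onto (its composite with `c ↦ ∑ cᵢ vᵢ` is
`c ↦ c · G`), hence, read as an endomorphism of `L ≅ Rʳ`, one-to-one (Vasconcelos–Orzech: onto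
endomorphisms of finitely generated modules over commutative rings are isomorphisms; Mathlib's
`OrzechProperty.injective_of_surjective_endomorphism`), and then `c ↦ ∑ cᵢ vᵢ` is onto as well.
(The case `fⱼ = ⟨·, yⱼ⟩` of a Kronecker pairing is Hatcher 2002, §3.1, p. 198: cohomology classes
detected by homology classes; the case `fⱼ = B(·, vⱼ)` is `exists_basis_of_isUnit_gram`.)
[cite: HatcherAT2002, §3.1 p. 198 and Cor. 3.3] -/
theorem exists_basis_of_isUnit_eval {R : Type*} [CommRing R] [Nontrivial R] {L : Type*}
    [AddCommGroup L] [Module R L] [Module.Finite R L] [Module.Free R L] {r : ℕ}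
    (hr : Module.finrank R L ≤ r) (f : Fin r → L →ₗ[R] R) (v : Fin r → L)
    (hG : IsUnit (Matrix.of fun i j => f j (v i))) :
    ∃ b : Module.Basis (Fin r) R L, ∀ i, b i = v i := by
  set G : Matrix (Fin r) (Fin r) R := Matrix.of fun i j => f j (v i) with hGdef
  set ψ : (Fin r → R) →ₗ[R] L := Fintype.linearCombination R v with hψ
  have hφψ : ∀ c j, f j (ψ c) = Matrix.vecMul c G j := fun c j =>
    apply_linearCombination_eq_vecMul f v c j
  have hinjG : Injective fun c : Fin r → R => Matrix.vecMul c G :=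
    Matrix.vecMul_injective_of_isUnit hG
  have hsurjG : Surjective fun c : Fin r → R => Matrix.vecMul c G :=
    Matrix.vecMul_surjective_iff_isUnit.2 hG
  -- `ψ` is injective: `v` is linearly independent, so `rank L = r`
  have hinjψ : Injective ψ := by
    intro c c' h
    refine hinjG (funext fun j => ?_)
    change Matrix.vecMul c G j = Matrix.vecMul c' G j
    rw [← hφψ, ← hφψ, h]
  have hli : LinearIndependent R v := by
    rw [Fintype.linearIndependent_iff]
    intro c hc i
    have h0 : ψ c = ψ 0 := by
      rw [map_zero, hψ, Fintype.linearCombination_apply]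
      exact hc
    exact congrFun (hinjψ h0) i
  have hrank : Module.finrank R L = r := by
    refine le_antisymm hr ?_
    have := hli.fintype_card_le_finrank
    rwa [Fintype.card_fin] at this
  -- `φ x = (fⱼ(x))ⱼ` is surjective, hence injective (an endomorphism of `L ≅ Rʳ`)
  let φ : L →ₗ[R] (Fin r → R) := LinearMap.pi f
  have hφ : ∀ x j, φ x j = f j x := fun x j => rfl
  have hsurjφ : Surjective φ := fun y => by
    obtain ⟨c, hc⟩ := hsurjG y
    refine ⟨ψ c, funext fun j => ?_⟩
    rw [hφ, hφψ]
    exact congrFun hc j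
  let e : L ≃ₗ[R] (Fin r → R) := (Module.finBasisOfFinrankEq R L hrank).equivFun
  have hinjφ : Injective φ := by
    have hs : Surjective (e.symm.toLinearMap ∘ₗ φ) := e.symm.surjective.comp hsurjφ
    have hi := OrzechProperty.injective_of_surjective_endomorphism _ hs
    intro x y h
    apply hi
    change e.symm (φ x) = e.symm (φ y)
    rw [h]
  -- hence `ψ` is surjective and `v` is a basis
  have hsurjψ : Surjective ψ := fun x => by
    obtain ⟨c, hc⟩ := hsurjG (φ x)
    refine ⟨c, hinjφ (funext fun j => ?_)⟩
    rw [hφ, hφψ, hφ]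
    exact congrFun hc j
  have hsp : ⊤ ≤ Submodule.span R (Set.range v) := by
    rw [← Fintype.range_linearCombination R v]
    rintro x -
    exact LinearMap.mem_range.2 (hsurjψ x)
  exact ⟨Module.Basis.mk hli hsp, fun i => Module.Basis.mk_apply hli hsp i⟩

/-- **Vectors with invertible Gram matrix form a basis.** Let `L` be a finitely generated free
module over a nontrivial commutative ring `R` with `rank L ≤ r`, `B` a bilinear form on `L` and
`v₁, …, vᵣ ∈ L` with invertible Gram matrix `G = (B(vᵢ, vⱼ))ᵢⱼ`. Then `v` is a basis of `L`
(`exists_basis_of_isUnit_eval` for the functionals `B(·, vⱼ)`). Milnor–Husemoller 1973, I §3: a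
sublattice on which the form is unimodular is a direct summand — of full rank, it is the whole
lattice. [cite: MilnorHusemoller1973, I §3] -/
theorem exists_basis_of_isUnit_gram {R : Type*} [CommRing R] [Nontrivial R] {L : Type*}
    [AddCommGroup L] [Module R L] [Module.Finite R L] [Module.Free R L] {r : ℕ}
    (hr : Module.finrank R L ≤ r) (B : LinearMap.BilinForm R L) (v : Fin r → L)
    (hG : IsUnit (Matrix.of fun i j => B (v i) (v j))) :
    ∃ b : Module.Basis (Fin r) R L, ∀ i, b i = v i :=
  exists_basis_of_isUnit_eval hr (fun j => B.flip (v j)) v hG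

/-- **`Γ₈` is invertible over `ℤ`**: `Γ₈ = Pᵀ E₈ P` with `P` a signed permutation matrix
(`KosinskiGamma8.lean`) and `det E₈ = ±1` (`isUnit_det_E₈`). [cite: Kosinski1993, VI.12, p. 122 ("Since Γ₈ is unimodular")] -/
theorem isUnit_kosinskiGamma8 : IsUnit kosinskiGamma8 := by
  have hP : IsUnit kosinskiGamma8ToE₈ := (Matrix.isUnit_iff_isUnit_det _).2
    (Matrix.isUnit_det_of_right_inverse kosinskiGamma8ToE₈_mul_transpose)
  have hPt : IsUnit kosinskiGamma8ToE₈ᵀ := (Matrix.isUnit_iff_isUnit_det _).2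
    (Matrix.isUnit_det_of_right_inverse kosinskiGamma8ToE₈_transpose_mul)
  have hE : IsUnit CartanMatrix.E₈ := (Matrix.isUnit_iff_isUnit_det _).2 isUnit_det_E₈
  rw [← transpose_kosinskiGamma8ToE₈_mul_E₈_mul]
  exact (hPt.mul hE).mul hP

/-! ### The reduction to eight classes and their cup products -/

namespace HomotopySphere

/-- **The `E₈` leaf from eight middle-dimensional classes of the closed model.** The named fact
`exists_intersectionForm_equivalent_e8Form` (Kosinski 1993, VI.12 with (12.2) and IX.(7.5))
follows from the following data, for every `n + 1 = 4m`, `1 < m`: a homotopy `n`-sphere `Σ`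
(`= ∂M(4m)`, a homotopy sphere by VI.(12.2), with any smooth orientation), a null-cobordism `c`
of `Σ` with `c.W` (`= M(4m)`) s-parallelizable (IX.(7.5): "the manifolds `M(4n)` are
parallelizable"), a relative fundamental class `z = [W, ∂W] ∈ H₄ₘ(W, ∂W; ℤ)` (an orientation of
`W`), the bound `rank_ℤ H²ᵐ(M̂; ℤ)/T ≤ 8` for the closed model `M̂ = M ∪ cone(bM)` (VI.12: `M(4n)`
is a handlebody on eight `2m`-handles), and eight classes `a₁, …, a₈ ∈ H²ᵐ(M̂; ℤ)` — the duals of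
the presentation spheres `Σ₁, …, Σ₈` — whose cup products evaluate on the class
`ẑ = j⁻¹ q_* z ∈ H₄ₘ(M̂; ℤ)` (`NullCobordism.closedModelClass`, Hatcher Prop. 2.22) to the
intersection numbers of the plumbing: `⟨aᵢ ⌣ aᵢ, ẑ⟩ = 2` for all `i`, or `-2` for all `i`
((12.4): `[Σᵢ : Σᵢ] = φ_*(τ₂ₘ) = χ(S²ᵐ) = 2`, the sign being that of the orientation `z`), and
`|⟨aᵢ ⌣ aⱼ, ẑ⟩| = (Γ₈)ᵢⱼ` for `i ≠ j` ((12.3): "`[Σ₁ : Σ₂] = ±1`" at the edges of the `E₈` tree,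
`0` off the tree; the matrix `Γ₈` of p. 122). No manifold structure, orientation or basis of the
closed model is required. Proof: orient `M̂` by `z`, or by `-z` when the diagonal is `-2`
(`NullCobordism.closedModelOrientation`, chart-free; `[M̂] = ±ẑ`,
`fundamentalClass_closedModelOrientation`, `closedModelClass_neg`), so that the cup-product form
`Q(a, b) = ⟨a ⌣ b, [M̂]⟩` has the given table `g` with diagonal `2`; Kosinski's sign change `s`
along the tree (`kosinskiSigns_mul_mul`) exhibits `g = diag(s) Γ₈ diag(s)`, invertible over `ℤ`
(`isUnit_kosinskiGamma8`); `H²ᵐ(M̂; ℤ)` is finitely generated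
(`isUnimodular_intersectionForm_closedModel`, Kervaire–Milnor p. 528 with footnote) and
`rank H²ᵐ/T ≤ 8`, so the classes give a basis of `H²ᵐ(M̂; ℤ)/T` (`exists_basis_of_isUnit_gram`);
`∂z` orients `Σ` with `(Σ, μ) = bM` (`NullCobordism.isOrientedBy_closedModelOrientation`);
conclude by `exists_intersectionForm_equivalent_e8Form_of_gamma8'`.
[cite: Kosinski1993, VI.12 (pp. 119–122: M(4n), Γ₈ on p. 122, (12.2), (12.3), (12.4)) and IX.(7.5) (p. 188); used in Ch. X §6, proof of Prop. 6.2(a), p. 216] [cite: KervaireMilnorAnnals1963, §2 ("-M") and §7 with footnote pp. 528–529] -/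
theorem exists_intersectionForm_equivalent_e8Form_of_kroneckerPairing
    (H : ∀ (n m : ℕ) (h : n + 1 = 4 * m) (hm : 1 < m),
      ∃ (S : HomotopySphere n) (c : NullCobordism n S.carrier)
        (z : relativeSingularHomology ℤ ℤ c.W ((𝓡∂ (n + 1)).boundary c.W) (n + 1)),
        IsStablyParallelizable (𝓡∂ (n + 1)) c.W ∧
        IsRelFundamentalClass ℤ ((𝓡∂ (n + 1)).boundary c.W) z ∧
        Module.finrank ℤ ↥(freeCohomology ℤ (ClosedModel n c.W) (2 * m)) ≤ 8 ∧
        ∃ a : Fin 8 → ↥(singularCohomology ℤ ℤ (ClosedModel n c.W) (2 * m)),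
          ((∀ i, kroneckerPairing ℤ ℤ (ClosedModel n c.W) (n + 1)
              (cupProduct (show 2 * m + 2 * m = n + 1 by omega) (a i) (a i))
              (c.closedModelClass ℤ ℤ (show 1 ≤ n by omega) z) = 2) ∨
            ∀ i, kroneckerPairing ℤ ℤ (ClosedModel n c.W) (n + 1)
              (cupProduct (show 2 * m + 2 * m = n + 1 by omega) (a i) (a i))
              (c.closedModelClass ℤ ℤ (show 1 ≤ n by omega) z) = -2) ∧
          ∀ i j, i ≠ j →
            |kroneckerPairing ℤ ℤ (ClosedModel n c.W) (n + 1)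
                (cupProduct (show 2 * m + 2 * m = n + 1 by omega) (a i) (a j))
                (c.closedModelClass ℤ ℤ (show 1 ≤ n by omega) z)| = kosinskiGamma8 i j) :
    exists_intersectionForm_equivalent_e8Form := by
  refine exists_intersectionForm_equivalent_e8Form_of_gamma8' fun n m h hm => ?_
  obtain ⟨S, c, z, hspar, hz, hrank, a, hdiag, hoff⟩ := H n m h hm
  have hn1 : 1 ≤ n := by omega
  have hk : 2 * m + 2 * m = n + 1 := by omega
  haveI : Nonempty S.carrier := S.nonempty
  haveI : ConnectedSpace S.carrier := S.connectedSpace (by omega)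
  obtain ⟨n', rfl⟩ : ∃ n', n = n' + 1 := ⟨n - 1, by omega⟩
  obtain ⟨κ⟩ := BoundaryData.nonempty_collar_of_compactSpace n' c.W c.boundaryData
  -- Step 1: an orientation `μ'` of the closed model with `(Σ, μ) = bM`, `[M̂]` a fundamental
  -- class, and classes with cup-product table of diagonal `+2`
  obtain ⟨μ, μ', hob, hfc, a₁, hdiag₁, hoff₁⟩ :
      ∃ (μ : HomologicalOrientation ℤ S.carrier (n' + 1))
        (μ' : HomologicalOrientation ℤ (ClosedModel (n' + 1) c.W) (n' + 1 + 1)),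
        c.IsOrientedBy μ μ' ∧ (∃ w, IsFundamentalClass μ' w) ∧
        ∃ a₁ : Fin 8 → ↥(singularCohomology ℤ ℤ (ClosedModel (n' + 1) c.W) (2 * m)),
          (∀ i, cupPairing μ' hk (a₁ i) (a₁ i) = 2) ∧
          ∀ i j, i ≠ j → |cupPairing μ' hk (a₁ i) (a₁ j)| = kosinskiGamma8 i j := by
    rcases hdiag with hd | hd
    · refine ⟨_, c.closedModelOrientation κ ℤ hn1 hz, c.isOrientedBy_closedModelOrientation κ hn1 hz,
        ⟨_, c.isFundamentalClass_closedModelClass κ ℤ hn1 hz⟩, a, fun i => ?_, fun i j hij => ?_⟩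
      · rw [cupPairing_apply, c.fundamentalClass_closedModelOrientation κ ℤ hn1 hz]
        exact hd i
      · rw [cupPairing_apply, c.fundamentalClass_closedModelOrientation κ ℤ hn1 hz]
        exact hoff i j hij
    · -- reverse the orientation of `W`: `[M̂]_{-z} = -ẑ`
      refine ⟨_, c.closedModelOrientation κ ℤ hn1 hz.neg,
        c.isOrientedBy_closedModelOrientation κ hn1 hz.neg,
        ⟨_, c.isFundamentalClass_closedModelClass κ ℤ hn1 hz.neg⟩, a, fun i => ?_,
        fun i j hij => ?_⟩
      · rw [cupPairing_apply, c.fundamentalClass_closedModelOrientation κ ℤ hn1 hz.neg,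
          c.closedModelClass_neg, map_neg, hd i, _root_.neg_neg]
      · rw [cupPairing_apply, c.fundamentalClass_closedModelOrientation κ ℤ hn1 hz.neg,
          c.closedModelClass_neg, map_neg, abs_neg]
        exact hoff i j hij
  -- Step 2: the table `g` is `Γ₈` up to the sign change `s` along the tree, hence invertible
  set g : Fin 8 → Fin 8 → ℤ := fun i j => cupPairing μ' hk (a₁ i) (a₁ j) with hgdef
  have hsymmQ : (intersectionForm hk μ').IsSymm :=
    isSymm_intersectionForm (cupProduct_gradedComm_holds ℤ _) (even_two_mul m) hk μ'
  have hgs : ∀ i j, g j i = g i j := fun i j =>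
    hsymmQ.eq (freeCohomology.mk (a₁ j)) (freeCohomology.mk (a₁ i))
  set s : Fin 8 → ℤ := kosinskiSigns g with hsdef
  have hgΓ : ∀ i j, g i j = s i * kosinskiGamma8 i j * s j := by
    intro i j
    have h1 := kosinskiSigns_mul_mul hgs hdiag₁ hoff₁ i j
    have h2 := kosinskiSigns_mul_self hoff₁ i
    have h3 := kosinskiSigns_mul_self hoff₁ j
    linear_combination (s i * s j) * h1 - (g i j * s j * s j) * h2 - g i j * h3
  have hS : IsUnit (Matrix.diagonal s) := by
    rw [Matrix.isUnit_diagonal]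
    exact isUnit_iff_exists_inv.2 ⟨s, funext fun i => kosinskiSigns_mul_self hoff₁ i⟩
  have hunit : IsUnit (Matrix.of fun i j =>
      intersectionForm hk μ' (freeCohomology.mk (a₁ i)) (freeCohomology.mk (a₁ j))) := by
    have hM : (Matrix.of fun i j =>
        intersectionForm hk μ' (freeCohomology.mk (a₁ i)) (freeCohomology.mk (a₁ j))) =
        Matrix.diagonal s * kosinskiGamma8 * Matrix.diagonal s := by
      ext i j
      rw [Matrix.of_apply, intersectionForm_mk_mk, Matrix.mul_diagonal, Matrix.diagonal_mul]
      exact hgΓ i j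
    rw [hM]
    exact (hS.mul isUnit_kosinskiGamma8).mul hS
  -- Step 3: the images in `H²ᵐ(M̂; ℤ)/T` form a basis (`H²ᵐ` finitely generated, rank `≤ 8`)
  have hp : 3 ≤ 2 * m := by omega
  obtain ⟨-, hfin⟩ := S.isUnimodular_intersectionForm_closedModel c hob hfc hp hk
  haveI := hfin
  obtain ⟨hF1, hF2⟩ := finite_free_freeCohomology_of_finite (R := ℤ)
    (Y := ClosedModel (n' + 1) c.W) (2 * m)
  haveI := hF1
  haveI := hF2
  obtain ⟨b, hb⟩ := exists_basis_of_isUnit_gram hrank (intersectionForm hk μ')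
    (fun i => freeCohomology.mk (a₁ i)) hunit
  -- Step 4: in this basis the form has diagonal `2` and `|off-diagonal| = Γ₈`
  refine ⟨S, μ, c, μ', hspar, hob, b, fun i => ?_, fun i j hij => ?_⟩
  · rw [hb, intersectionForm_mk_mk]
    exact hdiag₁ i
  · rw [hb, hb, intersectionForm_mk_mk]
    exact hoff₁ i j hij

end HomotopySphere

end Literature.Topology.FourManifolds

end
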